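import Mathlib

/- `set_option linter.dupNamespace false` as in the sibling kernel files (namespace `…Theorems.<FileStem>`). -/
set_option linter.dupNamespace false

/-!
# Slot-freeing: the combinatorial core of gap propagation (decomp-mm · lens 3 · gen 23, K3-core)

Context: route `route-MatrixMultiplication-ObstructionDescent` (`ω(ℂ) = 2`), attacked leaf `E = NoPolyDegreeObstruction`
(item 30889), DEGREE axis; aside `GapPropagation` (item 27779): if `I_d(σ_{d−1}) = 0` for all `d ≥ d₀` then
`I_e(σ_m) = 0` for `m < e ≤ 2m − d₀ + 2` (NODE-g23 §3, Theorem C).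

After polarisation (`f ↦ F` symmetric `e`-linear, restricted to tuples of rank-one tensors, Raicu's «generic
multiprolongations») the theorem is a statement about a function `F : (Fin e → X) → M` on tuples:
* (given) `F w = 0` whenever `w` takes at most `m` distinct values (`f` vanishes on `σ_m`);
* (gap-one input, one instance per prefix length `p`) if `F` vanishes at every tuple with a prescribed `p`-prefix whose
  slots `p`, `p+1` carry the same entry, then `F` vanishes at every tuple with that prefix (this is `I_s(σ_{s−1}) = 0`
  for the suffix length `s = e − p ≥ d₀`, applied to `Φ = F(y, ·)`);
* (conclusion) `F = 0`.
The proof is the chain `M(0;0) ⟸ M(2;1) ⟸ … ⟸ M(2k;k)` (`k = e − m`), where `M(p;r)` = «`F w = 0` whenever the first `p`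
slots of `w` take `≤ r` values»: each step frees two slots at the cost of one value (`slotFreeing_step`), and `M(2k;k)`
is the given vanishing because `k + (e − 2k) = m` (`slotFreeing_base`).  No symmetry or linearity of `F` is used here;
those enter only when the gap-one input is discharged from `GapOneEquationsVanish` (item 27778; kernels
`ObstructionDescentCasimirCount`, `ObstructionDescentPairCasimir`).

References: Landsberg–Manivel, Found. Comput. Math. 4 (2004) Lemma 3.1 / Prop. 3.3; Raicu, Algebra Number Theory 6
(2012) Prop. 3.4 / Def. 3.13.  The slot-freeing chain is this cell's (NODE-g23 §3).
-/

namespace Summit.MatrixMultiplication.MatrixMultiplication.Theorems.ObstructionDescentSlotFreeing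

open Finset

variable {X : Type*} [DecidableEq X] {M : Type*} [Zero M] {e : ℕ}

/-- The set of values taken by the first `p` slots of a tuple. [this cell] -/
def headImage (p : ℕ) (w : Fin e → X) : Finset X := (univ.filter fun i : Fin e => i.val < p).image w

/-- No slots, no values. [this cell] -/
theorem headImage_zero (w : Fin e → X) : headImage 0 w = ∅ := by
  simp [headImage]

/-- The head image only depends on the prefix. [this cell] -/
theorem headImage_congr {p : ℕ} {w w' : Fin e → X} (h : ∀ i : Fin e, i.val < p → w' i = w i) :
    headImage p w' = headImage p w := by
  unfold headImage
  refine Finset.image_congr ?_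
  intro i hi
  have hi' : i.val < p := by simpa using hi
  exact h i hi'

/-- Two more slots carrying one common entry add at most one value. [this cell] -/
theorem headImage_add_two_subset {p : ℕ} (w : Fin e → X) (i₀ : Fin e) (hi₀ : i₀.val = p)
    (hdbl : ∀ i j : Fin e, i.val = p → j.val = p + 1 → w i = w j) :
    headImage (p + 2) w ⊆ insert (w i₀) (headImage p w) := by
  intro x hx
  simp only [headImage, mem_image, mem_filter, mem_univ, true_and] at hx
  obtain ⟨i, hi, rfl⟩ := hx
  rw [mem_insert]
  by_cases h1 : i.val < p
  · right
    simp only [headImage, mem_image, mem_filter, mem_univ, true_and]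
    exact ⟨i, h1, rfl⟩
  · left
    have h2 : i.val = p ∨ i.val = p + 1 := by omega
    rcases h2 with h2 | h2
    · have : i = i₀ := Fin.ext (by rw [h2, hi₀])
      rw [this]
    · exact (hdbl i₀ i hi₀ h2).symm

/-- All values = head values + at most one value per remaining slot. [this cell] -/
theorem card_image_le_card_headImage_add (p : ℕ) (hp : p ≤ e) (w : Fin e → X) :
    (univ.image w).card ≤ (headImage p w).card + (e - p) := by
  have hsplit : univ.image w ⊆ headImage p w ∪ (univ.filter fun i : Fin e => ¬ i.val < p).image w := by
    intro x hx
    simp only [mem_image, mem_univ, true_and] at hx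
    obtain ⟨i, rfl⟩ := hx
    rw [mem_union]
    by_cases h : i.val < p
    · left
      simp only [headImage, mem_image, mem_filter, mem_univ, true_and]
      exact ⟨i, h, rfl⟩
    · right
      simp only [mem_image, mem_filter, mem_univ, true_and]
      exact ⟨i, h, rfl⟩
  have htail : ((univ.filter fun i : Fin e => ¬ i.val < p).image w).card ≤ e - p := by
    refine le_trans Finset.card_image_le ?_
    have h := Finset.card_le_card_of_injOn (s := univ.filter fun i : Fin e => ¬ i.val < p)
      (t := Finset.range (e - p)) (fun i : Fin e => i.val - p) ?_ ?_
    · simpa using h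
    · intro i hi
      simp only [coe_filter, mem_univ, true_and, Set.mem_setOf_eq] at hi
      simp only [coe_range, Set.mem_Iio]
      have := i.isLt
      omega
    · intro i hi j hj hij
      simp only [coe_filter, mem_univ, true_and, Set.mem_setOf_eq] at hi hj
      apply Fin.ext
      have : i.val - p = j.val - p := hij
      omega
  calc (univ.image w).card
      ≤ (headImage p w ∪ (univ.filter fun i : Fin e => ¬ i.val < p).image w).card := Finset.card_le_card hsplit
    _ ≤ (headImage p w).card + ((univ.filter fun i : Fin e => ¬ i.val < p).image w).card := Finset.card_union_le _ _
    _ ≤ (headImage p w).card + (e - p) := by omega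

section Core

variable (F : (Fin e → X) → M)

/-
Notation used in the docstrings below (spelled out in the statements, no `def : Prop`):
`M(p; r)`  := `∀ w, (headImage p w).card ≤ r → F w = 0` — `F` vanishes at every tuple whose first `p` slots take `≤ r` values;
`Gap(p)`   := the gap-one input at prefix length `p`: for every `w`, if `F w' = 0` for all `w'` agreeing with `w` on the
first `p` slots and having equal entries in slots `p`, `p+1`, then `F w = 0`.
-/

/-- BASE `M(2k; k)` from the given vanishing on `≤ m = e − k` values. [this cell, NODE-g23 §3] -/
theorem slotFreeing_base (m k : ℕ) (hk : e = m + k) (h2 : 2 * k ≤ e)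
    (hgiven : ∀ w : Fin e → X, (univ.image w).card ≤ m → F w = 0) :
    ∀ w : Fin e → X, (headImage (2 * k) w).card ≤ k → F w = 0 := by
  intro w hw
  apply hgiven
  have h := card_image_le_card_headImage_add (2 * k) h2 w
  omega

/-- STEP `Gap(p) ∧ M(p+2; r+1) ⟹ M(p; r)`: free two slots at the cost of one value. [this cell, NODE-g23 §3] -/
theorem slotFreeing_step (p r : ℕ) (hp : p + 2 ≤ e)
    (hM : ∀ w : Fin e → X, (headImage (p + 2) w).card ≤ r + 1 → F w = 0)
    (hgap : ∀ w : Fin e → X, (∀ w' : Fin e → X, (∀ i : Fin e, i.val < p → w' i = w i) →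
      (∀ i j : Fin e, i.val = p → j.val = p + 1 → w' i = w' j) → F w' = 0) → F w = 0) :
    ∀ w : Fin e → X, (headImage p w).card ≤ r → F w = 0 := by
  intro w hw
  apply hgap w
  intro w' hpre hdbl
  apply hM w'
  obtain ⟨i₀, hi₀⟩ : ∃ i₀ : Fin e, i₀.val = p := ⟨⟨p, by omega⟩, rfl⟩
  calc (headImage (p + 2) w').card
      ≤ (insert (w' i₀) (headImage p w')).card :=
        Finset.card_le_card (headImage_add_two_subset w' i₀ hi₀ hdbl)
    _ ≤ (headImage p w').card + 1 := Finset.card_insert_le _ _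
    _ = (headImage p w).card + 1 := by rw [headImage_congr hpre]
    _ ≤ r + 1 := by omega

/-- SLOT-FREEING (combinatorial core of `GapPropagation`).  Let `m < e ≤ 2m` and `k = e − m`.  If `F` vanishes at
every tuple with at most `m` values, and the gap-one input `Gap(p)` holds at every prefix length `p ≤ 2k − 2`, then
`F = 0`.  (For `GapPropagation` the suffix lengths `e − p ≥ e − 2k + 2 = 2m − e + 2` are `≥ d₀` exactly when
`e ≤ 2m − d₀ + 2`.) [this cell, NODE-g23 §3 Theorem C] -/
theorem slotFreeing (m : ℕ) (hme : m < e) (h2 : e ≤ 2 * m)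
    (hgiven : ∀ w : Fin e → X, (univ.image w).card ≤ m → F w = 0)
    (hgap : ∀ p : ℕ, p + 2 ≤ 2 * (e - m) → ∀ w : Fin e → X, (∀ w' : Fin e → X, (∀ i : Fin e, i.val < p → w' i = w i) →
      (∀ i j : Fin e, i.val = p → j.val = p + 1 → w' i = w' j) → F w' = 0) → F w = 0) :
    ∀ w : Fin e → X, F w = 0 := by
  obtain ⟨k, hk⟩ : ∃ k, e = m + k := ⟨e - m, by omega⟩
  have hkpos : 2 * k ≤ e := by omega
  -- descending chain: `M(2j; j)` for every `j ≤ k`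
  have chain : ∀ t j : ℕ, j + t = k → ∀ w : Fin e → X, (headImage (2 * j) w).card ≤ j → F w = 0 := by
    intro t
    induction t with
    | zero =>
      intro j hj
      have hj' : j = k := by omega
      subst hj'
      exact slotFreeing_base F m j hk hkpos hgiven
    | succ t ih =>
      intro j hj
      have hM : ∀ w : Fin e → X, (headImage (2 * j + 2) w).card ≤ j + 1 → F w = 0 := by
        have := ih (j + 1) (by omega)
        simpa [Nat.mul_succ] using this
      refine slotFreeing_step F (2 * j) j (by omega) hM (hgap (2 * j) ?_)
      have : e - m = k := by omega
      rw [this]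
      omega
  intro w
  refine chain k 0 (by omega) w ?_
  simp [headImage_zero]

end Core

end Summit.MatrixMultiplication.MatrixMultiplication.Theorems.ObstructionDescentSlotFreeing
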